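import Mathlib
import HarnessLib
import Summits.CriticalPhenomena.CardyFormulaZ2.Theses.CardyComplexCone
import Literature.Probability.LatticeModels.ExplorationWinding
import Summits.CriticalPhenomena.CardyFormulaZ2.Theorems.CardyComplexConeEdgeCoherenceDefs

/-!
# Stub `stub_oneCut` of line `Sketch` (composition `FixedRadiusCut`) for crux `CardyComplexCone.EdgeCoherence`

Item stmt-CriticalPhenomena-11385, helper file `--supports stmt-CriticalPhenomena-11385`; proves the registered
stub `stub_oneCut : Sig.stub_oneCut`, i.e. `OneCutPresentation → InnerUniformCoherence → HarmonicVanishing`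
(vocabulary: `Theorems/CardyComplexConeEdgeCoherenceDefs.lean`).

## Content

The ONE-CUT lemma of the idea card `fixed-radius-equivariant-cut`: if the class vector at a vertex `v` is
presented through the δ-free inner response tensor of the lattice ball of a FIXED radius `ρ`
(`OneCutPresentation`: `E_δ(v, faceAt v c) = Σᶠ_l A(l)·T_ρ(l; c) + r(c)` with the mass × sup-signal envelope
`(Σ‖A‖)·‖T̂_ρ(β; e, 0)‖ ≤ C δ^{1/3}`, `C` uniform in `ρ`, and remainder aliases `≤ η(ρ) δ^{1/3}`, `η → 0`), and
the inner aliases are uniformly small against the inner signal for large `ρ` (`InnerUniformCoherence`), then the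
three non-trivial `ℤ₄`-harmonics of the class vector are `o(δ^{1/3})` locally uniformly (`HarmonicVanishing`).

## Proof outline (ρ first, δ second)

Fix `D, Λ, K, ε`; take `C, η` from the presentation and `ε₁ > 0` with `ε₁ (|C| + 1) = ε / 2`. The three
eventualities in `ρ` of `InnerUniformCoherence` (`k = 1, 2, 3`, tolerance `ε₁`) and `|η ρ| < ε / 2` hold at
ONE radius `ρ₀` (`atTop` on `ℕ` is non-trivial). Eventually in `δ`, at a vertex `v` over `K`, by linearity
in the class index `c`,
`H_k(v) = Σ_{l ∈ S} A l · T̂_{ρ₀}(l, k) + r̂_k` (`S` the finite support of `A`), and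
`‖Σ_{l∈S} A l · T̂(l,k)‖ ≤ Σ ‖A l‖ ‖T̂(l,k)‖ ≤ ε₁ Σ ‖A l‖ ‖T̂(l'_l,0)‖ ≤ ε₁ (Σ‖A l‖) max_l ‖T̂(l'_l,0)‖ ≤ ε₁ C δ^{1/3}`
(the witnesses `l'_l` have entry vertex outside the ball, so the envelope applies to the maximiser), which is
`≤ ε₁ (|C|+1) δ^{1/3} = (ε/2) δ^{1/3}`; the remainder contributes `≤ η(ρ₀) δ^{1/3} ≤ (ε/2) δ^{1/3}`.

Sources: H. Duminil-Copin, S. Smirnov, *Conformal invariance of lattice models*, Clay Math. Proc. 15 (2012) §8;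
idea card `Cruxes/EdgeCoherence/Ideas/fixed-radius-equivariant-cut.md`. Mathlib only (finsum API,
`Finset.exists_max_image`, filter algebra).
-/


noncomputable section

namespace Summit.CriticalPhenomena.CardyFormulaZ2.Cruxes.EdgeCoherence.FixedRadiusCut

open scoped BigOperators Topology
open Filter Set MeasureTheory
open Literature.Probability.LatticeModels Literature.Probability.RandomPlanarGeometry
open Literature.Probability.Percolation (BondConfig bondPercolation half)
open Summit.CriticalPhenomena.CardyFormulaZ2.Theses.CardyComplexCone (EdgeCoherence)

/-- Linearity in the class index: a presentation of the four corner observables through the inner tensor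
with finitely supported weights presents the `k`-th harmonic through the `k`-th inner harmonic, with the
`k`-th alias of the remainder. -/
private lemma harmonic_eq_sum_of_presentation {Λ : ℝ → DiscreteDobrushin} {δ : ℝ} {v : Site 2} {ρ k : ℕ}
    {A : BondConfig (Site 2) × (Site 2 × Fin 4) → ℂ} {r : Fin 4 → ℂ} (hfin : A.support.Finite)
    (hpres : ∀ c : Fin 4, cornerObs (Λ δ) δ v (faceAt v c) =
      (∑ᶠ l, A l * innerResp ρ l.1 l.2 c) + r c) :
    harmonic Λ δ k v = (∑ l ∈ hfin.toFinset, A l * innerHarmonic ρ l.1 l.2 k) +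
      ∑ c : Fin 4, Complex.I ^ (k * (c : ℕ)) * r c := by
  have hsum : ∀ c : Fin 4, (∑ᶠ l, A l * innerResp ρ l.1 l.2 c) =
      ∑ l ∈ hfin.toFinset, A l * innerResp ρ l.1 l.2 c := fun c =>
    finsum_eq_sum_of_support_subset_of_finite _ (Function.support_mul_subset_left _ _) hfin
  simp only [harmonic, hpres, hsum, innerHarmonic, mul_add, Finset.sum_add_distrib, Finset.mul_sum]
  congr 1
  rw [Finset.sum_comm]
  exact Finset.sum_congr rfl fun l _ => Finset.sum_congr rfl fun c _ => by ring

/-- The finsum of the norms of a finitely supported weight is the sum over its support. -/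
private lemma finsum_norm_eq_sum {A : BondConfig (Site 2) × (Site 2 × Fin 4) → ℂ}
    (hfin : A.support.Finite) : (∑ᶠ l, ‖A l‖) = ∑ l ∈ hfin.toFinset, ‖A l‖ :=
  finsum_eq_sum_of_support_subset_of_finite _ (fun l hl => by simpa [Function.mem_support] using hl) hfin

/-- Registered stub (one cut: presentation + inner coherence ⇒ `HarmonicVanishing`). -/
theorem stub_oneCut : Sig.stub_oneCut := by
  intro hP hI D Λ hΩ hδ hadm K hK hKD ε hε
  obtain ⟨C, η, hη, hρ⟩ := hP D Λ hΩ hδ hadm K hK hKD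
  obtain ⟨ε₁, hε₁, hε₁eq⟩ : ∃ ε₁ : ℝ, 0 < ε₁ ∧ ε₁ * (|C| + 1) = ε / 2 :=
    ⟨ε / (2 * (|C| + 1)), by positivity, by field_simp⟩
  -- the inner coherence for the three aliases at tolerance `ε₁`, eventually in `ρ`
  have hIev : ∀ᶠ ρ : ℕ in atTop, ∀ k ∈ ({1, 2, 3} : Finset ℕ),
      ∀ (β : BondConfig (Site 2)) (e : Site 2 × Fin 4), ¬ InBall ρ e.1 →
        ∃ (β' : BondConfig (Site 2)) (e' : Site 2 × Fin 4), ¬ InBall ρ e'.1 ∧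
          ‖innerHarmonic ρ β e k‖ ≤ ε₁ * ‖innerHarmonic ρ β' e' 0‖ :=
    (Filter.eventually_all_finset _).2 fun k hk => hI k hk ε₁ hε₁
  -- the remainder coefficient is eventually below `ε / 2`
  have hηev : ∀ᶠ ρ : ℕ in atTop, |η ρ| < ε / 2 := by
    have := Metric.tendsto_nhds.1 hη (ε / 2) (half_pos hε)
    simpa [Real.dist_eq] using this
  -- FIX one radius
  obtain ⟨ρ₀, hI0, hη₀⟩ := (hIev.and hηev).exists
  filter_upwards [hρ ρ₀, self_mem_nhdsWithin] with δ hδ' hpos v hv k hk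
  obtain ⟨A, r, hfin, hout, hpres, henv, hrem⟩ := hδ' v hv
  have hδ3 : 0 ≤ δ ^ ((1:ℝ) / 3) := Real.rpow_nonneg (le_of_lt hpos) _
  rw [harmonic_eq_sum_of_presentation hfin hpres]
  -- the remainder aliases
  have hrem' : ‖∑ c : Fin 4, Complex.I ^ (k * (c : ℕ)) * r c‖ ≤ (ε / 2) * δ ^ ((1:ℝ) / 3) :=
    (hrem k hk).trans (mul_le_mul_of_nonneg_right ((le_abs_self _).trans hη₀.le) hδ3)
  -- the main term
  have hmain : ‖∑ l ∈ hfin.toFinset, A l * innerHarmonic ρ₀ l.1 l.2 k‖ ≤ (ε / 2) * δ ^ ((1:ℝ) / 3) := by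
    rcases hfin.toFinset.eq_empty_or_nonempty with hS | hS
    · rw [hS, Finset.sum_empty, norm_zero]
      positivity
    · have hW : ∀ l ∈ hfin.toFinset, ∃ (β' : BondConfig (Site 2)) (e' : Site 2 × Fin 4),
          ¬ InBall ρ₀ e'.1 ∧ ‖innerHarmonic ρ₀ l.1 l.2 k‖ ≤ ε₁ * ‖innerHarmonic ρ₀ β' e' 0‖ :=
        fun l hl => hI0 k hk l.1 l.2 (hout l (hfin.mem_toFinset.1 hl))
      choose! β' e' hout' hle using hW
      obtain ⟨m, hmS, hmax⟩ :=
        Finset.exists_max_image hfin.toFinset (fun l => ‖innerHarmonic ρ₀ (β' l) (e' l) 0‖) hS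
      have henv' : (∑ l ∈ hfin.toFinset, ‖A l‖) * ‖innerHarmonic ρ₀ (β' m) (e' m) 0‖ ≤
          C * δ ^ ((1:ℝ) / 3) := by
        rw [← finsum_norm_eq_sum hfin]
        exact henv (β' m) (e' m) (hout' m hmS)
      calc ‖∑ l ∈ hfin.toFinset, A l * innerHarmonic ρ₀ l.1 l.2 k‖
          ≤ ∑ l ∈ hfin.toFinset, ‖A l * innerHarmonic ρ₀ l.1 l.2 k‖ := norm_sum_le _ _
        _ ≤ ∑ l ∈ hfin.toFinset, ‖A l‖ * (ε₁ * ‖innerHarmonic ρ₀ (β' m) (e' m) 0‖) :=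
            Finset.sum_le_sum fun l hl => by
              rw [norm_mul]
              exact mul_le_mul_of_nonneg_left
                ((hle l hl).trans (mul_le_mul_of_nonneg_left (hmax l hl) hε₁.le)) (norm_nonneg _)
        _ = ε₁ * ((∑ l ∈ hfin.toFinset, ‖A l‖) * ‖innerHarmonic ρ₀ (β' m) (e' m) 0‖) := by
            rw [← Finset.sum_mul]; ring
        _ ≤ ε₁ * (C * δ ^ ((1:ℝ) / 3)) := mul_le_mul_of_nonneg_left henv' hε₁.le
        _ ≤ ε₁ * ((|C| + 1) * δ ^ ((1:ℝ) / 3)) :=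
            mul_le_mul_of_nonneg_left (mul_le_mul_of_nonneg_right
              ((le_abs_self C).trans (le_add_of_nonneg_right zero_le_one)) hδ3) hε₁.le
        _ = (ε / 2) * δ ^ ((1:ℝ) / 3) := by rw [← mul_assoc, hε₁eq]
  calc ‖(∑ l ∈ hfin.toFinset, A l * innerHarmonic ρ₀ l.1 l.2 k) +
        ∑ c : Fin 4, Complex.I ^ (k * (c : ℕ)) * r c‖
      ≤ ‖∑ l ∈ hfin.toFinset, A l * innerHarmonic ρ₀ l.1 l.2 k‖ +
        ‖∑ c : Fin 4, Complex.I ^ (k * (c : ℕ)) * r c‖ := norm_add_le _ _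
    _ ≤ (ε / 2) * δ ^ ((1:ℝ) / 3) + (ε / 2) * δ ^ ((1:ℝ) / 3) := add_le_add hmain hrem'
    _ = ε * δ ^ ((1:ℝ) / 3) := by ring

end Summit.CriticalPhenomena.CardyFormulaZ2.Cruxes.EdgeCoherence.FixedRadiusCut

end
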